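import Summits.QuantumFields.BalabanUV.T4Continuum.Spine.NE1p.DressedSmallFieldMixedDerivativeFTC
import Summits.QuantumFields.BalabanUV.T4Continuum.Spine.NE1p.DressedSmallFieldMixedDerivativeLetter

/-!
# T⁴ programme, spine estimate NE1′ (node O3b/H2) — THE PARAMETER MEASURE SPLITS: W39.1's cube letter IS, literally, the `ds`-integral of
# W55's angular letter ((1.23)∕(2.14)'s «∫ ds(Δ) (1∕2πi) ∫ dσ(Δ)∕(σ(Δ) − s(Δ))²», `ds` outside the contour, in kernel), and the lineage's three
# kernel routes (contours ⇒ `Δ_S`, W39.1; contours at fixed `s` ⇒ `∂_S`, W55; `∫ds ∂_S = Δ_S`, W62) provably COMMUTE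

Cell `pub-balaban`, sub-cell `t4`, row NE1′ formalisation crew (`t4/formal/NE1p/LEAVES.md` row W⟨next⟩ — own-initiative DICTIONARY∕BRIDGE follower
of the unit's W39∕W55∕W57∕W60∕W62∕W64 under typer R-T61 (ii); INTENT journal l.≈22227), unit `b2b-balaban-t4-ne1p-formalise-leaf-08` (gen 12).
ADDITIVE — imports W62 `Spine/NE1p/DressedSmallFieldMixedDerivativeFTC` + W55 PART 2 `Spine/NE1p/DressedSmallFieldMixedDerivativeLetter` ONLY
(→ W55 PART 1: `enumS`, `basePt`; → W39.1: `μS`, `cw`, `wS`, `σc`, `σS`, `mixedDiff`, `mixedDiff_pair`∕`_zero`, `measurable_wS`∕`measurable_σS`∕`norm_σS_le`∕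
`norm_wS_le`, `pi_μS_univ`∕`wS_univ`∕`σS_univ`; W55 PART 2: `θS`, `pairθ`, `mixedDerivLetter_rep`, `mixedDerivLetter_majorant_le`, `θS_univ`; W62: `sS`,
`cubePt`, `integral_mixedDeriv_cubePt_eq_mixedDiff`; the NE5 substrate `Support/B13TermContours`: `lam₁`, `w₁`, `interp` (+ `interp_nonneg`∕`_le_one`∕
`_eq_self`), `lamJ`, `wJ`, `sigmaJ`; the Literature module `Dimock2011to13/PolydiscCauchyBounds`: `mixedDeriv` — all BY NAME).  THEOREMS ONLY +
two decided `example`s; 0 `def`, 0 `instance`, 0 `def … : Prop`, 0 cite, 0 sorry, 0 `attribute`; nothing upstream restated.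

WHY THIS FILE.  [Balaban1988RGII] p. 7 (1.23) «(1∕2πi) ∫ dt_□∕t_□² Π_{Δ⊂Y₀∖□̃⁴} ∫ ds(Δ) (1∕2πi) ∫ dσ(Δ)∕(σ(Δ) − s(Δ))² · E(□₀, (tζ̃_□ + t_□ζ_□)H_k(σ(Y₀), B′))»,
«the σ(Δ)-integrations are over the circles |σ(Δ)| = e^{κ₁}»; p. 15 (2.14) «Π_{Δ⊂Z∖Z′₀} ∫₀¹ ds(Δ) (1∕2πi) ∫ dσ(Δ)∕(σ(Δ) − s(Δ))² Π_{Y∈𝐃} ∫₀¹ dt(Y)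
(1∕2πi) ∫ dτ(Y)∕(τ(Y) − t(Y))² · … · exp[Σ_{Y∈𝐃} τ(Y)𝐕_k(Y,B)]» — LOCI of the audited manuscript read on the renders, TYPE∕CONTEXT only: for EVERY
cube the interpolation integral `∫ ds(Δ)` stands OUTSIDE its Cauchy contour; collecting the cubes (Fubini) puts all `ds` outside and all contours
inside — the form in which W55 (inner) and W62 (outer) compose.  The lineage holds THREE kernel presentations: W39.1's `mixedLetter_rep` integrates
the substrate's `lam₁ = ds|[0,1] ⊗ dθ|[0,2π]` CUBE BY CUBE and lands on `Δ_S F`; W55's `mixedDerivLetter_rep` integrates ALL the angles at a FIXED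
`s` and lands on Dimock's `∂_{enumS S} F (basePt S s)`; W62's `integral_mixedDeriv_cubePt_eq_mixedDiff` integrates ALL the `s` of that derivative and
lands on `Δ_S F` again.  Missing was the measure-theoretic statement tying them, and the check that the routes agree BY FUBINI, not only in value:
* §1 **`μS_eq_prod`: `μS S j = sS S j ⊗ θS S j`** for every cube (the substrate's `lam₁` IS the product by `rfl`; `δ₀ ⊗ δ₀ = δ_{(0,0)}` on an
  inactive cube); **`measurePreserving_zip`**: the zip `(s, θ) ↦ pairθ s θ` (Mathlib's `MeasurableEquiv.arrowProdEquivProdArrow⁻¹`) carries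
  `(⨂_j sS S j) ⊗ (⨂_j θS S j)` to `⨂_j μS S j` (Mathlib `measurePreserving_arrowProdEquivProdArrow`); hence **`integral_μS_eq_integral_prod`**
  (every integrand) and **`integral_μS_eq_integral_sS_θS`**: `∫ G d(⨂ μS S) = ∫ (∫ G(pairθ s θ) d(⨂ θS S)) d(⨂ sS S)` for `G` integrable —
  `ds` OUTSIDE, `dθ` INSIDE;
* §2 **`angularLetter_eq_mixedDeriv_cubePt`**: W55's representation holds at EVERY parameter `s ∈ ℝⁿ` once the point is read through W62's clamped
  `cubePt S s` — because the substrate's weight `w₁` reads `s` through the clamp `interp` (`wS_pairθ_interp`) and the contour does not read `s` at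
  all (`σS_pairθ`); **`mixedLetter_eq_integral_angularLetter`**: W39.1's letter `∫ wS·F∘σS d(⨂ μS S)` EQUALS `∫ ds (∫ dθ wS r S (s,θ)·F(σ_S(s,θ)))`
  for `F` continuous — (1.23)'s order, literally; **`mixedLetter_eq_integral_mixedDeriv'`**: W62 §3's identity RE-DERIVED from the split + W55
  (W39.1's induction NOT used); **`mixedLetter_rep_of_split`**: W39.1's `∫ wS·F∘σS d(⨂ μS S) = Δ_S F` RE-DERIVED from W55 + W62 + the split for
  `F` jointly entire-analytic — CENSUS: W39.1's `mixedLetter_rep` has 0 uses in this file; the three routes COMMUTE;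
* §3 `⨂_j sS S j` has MASS ONE (`sS_univ_eq_one`, `pi_sS_univ`); **`mixedLetter_majorant_of_split`**: W39.1's (2.15)-majorant
  `∫ ‖wS·F∘σS‖ ≤ (Π_{j∈S} r_j∕(r_j−1)²)·B` RE-DERIVED by integrating W55's angular majorant `mixedDerivLetter_majorant_le` over the unit cube;
* §4 **`cubePt_ae_eq_basePt`**: the clamp is invisible to `⨂ sS S` (`cubePt S = basePt S` a.e.: `interp = id` on `[0,1]`, Mathlib `ae_eq_pi`), hence
  the UNCLAMPED cube identity **`integral_mixedDeriv_basePt_eq_mixedDiff`**: `∫ ∂_{enumS S} F (basePt S s) d(⨂ sS S) = Δ_S F` (W62 §2 stated it at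
  `cubePt`; X188's reader mutant RM3 «true as mathematics» is now a theorem) and `mixedLetter_eq_integral_mixedDeriv_basePt`;
* §5 at `S = univ` the objects ARE the substrate's: **`substrateLetter_eq_integral_angularLetter`** (`lamJ`∕`wJ`∕`sigmaJ` in (2.14)'s order);
* §6 decided `example`s: the NON-product entire factor `e^{z₀z₁}` — `∫ ds ∫ dθ wS·e^{σ₀σ₁} = e − 1` at ANY radii `> 1` in (1.23)'s order (§2 +
  W39.1 `mixedDiff_pair`), and the decoupled second cube (`S = {0}`: the iterated letter of `e^{z₀z₁}` is `e⁰ − e⁰ = 0`).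

HONEST FRAMING.  [folklore] measure theory (Fubini across the `(s, θ)` split of the substrate's parameter measure through a measurable equivalence,
a.e.-bookkeeping of the clamp, mass of the unit cube) on OUR dictionary objects and the template lineage's kernel object `PolydiscCauchyBounds.mixedDeriv`
BY NAME; a CONSISTENCY∕DICTIONARY row, not an estimate of print: `F` ↔ print's s(Δ)-dependent operator products ((1.10)∕(1.23)∕(2.7)∕(2.14)) and the
radii ↔ (1.23)'s σ(Δ)-circles are TYPE READINGS; the analytic hypotheses are JOINT ENTIRE analyticity (`AnalyticOnNhd ℂ F univ`; the LOCAL version on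
print's open polydisc would follow W57's pattern and is NOT claimed here — W62's FTC is itself stated for entire `F`); the bound `‖F∘σS‖ ≤ B` in §3 is
a HYPOTHESIS of (1.18)∕(1.21) TYPE; no numeral of [Balaban1988RGII] asserted (k2); (B1) for Bałaban's (2.14) NOT discharged; (B3) = GAPS G-ne9p2-5
UNPRINTED — NOT discharged, untouched; (B5)
untouched; 0 binders instantiated on Bałaban's densities ∕ operators ∕ (2.14) data ∕ `d_k` ∕ minimisers ∕ backgrounds; discharges no wall item;
wall v1.8 (T4-DAG v48) does NOT move; R-t4r2-Q2 NOT met thereby; NE1′ ⇐ the named binders — NOT proved, NOT printed; spine PROVED 0∕9; count 9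
unchanged.  Rung (B)+1 on ONE finite four-torus — NOT infinite volume, NOT a mass gap, NOT OS on ℝ⁴, NOT Clay.  ABSOLUTE RULE honoured: the
quotations are LOCI of the audited manuscript [Balaban1988RGII] (CMP 116 (1988) 1–22, pp. 7, 15), TYPE∕CONTEXT only, never hypothesis-free facts;
[Dimock2013] enters only through the cite-tagged Literature module BY NAME; nothing internally minted is cited; [folklore] tags on kernel lemmas
only.  HONEST DEPENDENCY: continuum YM on T⁴ ⇐ BetaPertH ∧ nine spine estimates (0/9 proved); BetaPertH ⇐ (D1) ∧ (D4) ∧ CAP+tail; G-an2-4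
gates asym, D1 and NE2/3/4.
-/

noncomputable section

namespace Summit.QuantumFields.BalabanUV.T4Continuum.NE1p.DressedSmallFieldMixedDerivativeSplit

open MeasureTheory Metric Set Complex Finset Function Summit.QuantumFields.BalabanUV.T4Continuum.B13TermContours
open Summit.QuantumFields.BalabanUV.T4Continuum.NE1p.DressedSmallFieldMixedLetter Summit.QuantumFields.BalabanUV.T4Continuum.NE1p.DressedSmallFieldMixedDerivativeBridge
open Summit.QuantumFields.BalabanUV.T4Continuum.NE1p.DressedSmallFieldMixedDerivativeLetter Summit.QuantumFields.BalabanUV.T4Continuum.NE1p.DressedSmallFieldMixedDerivativeFTC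
open Literature.MathematicalPhysics.QuantumFieldTheory.Dimock2011to13.PolydiscCauchyBounds (mixedDeriv)

variable {n : ℕ}

/-! ## §1 THE COORDINATE MEASURES SPLIT, and the zip `(s, θ) ↦ pairθ s θ` carries `(⨂ sS) ⊗ (⨂ θS)` to `⨂ μS` -/

/-- **THE PARAMETER MEASURE OF ONE CUBE SPLITS** [folklore]: W39.1's `μS S j` = W62's interpolation measure `sS S j` ⊗ W55's angular measure
`θS S j` — on an active cube the substrate's `lam₁` IS `ds|[0,1] ⊗ dθ|[0,2π]` (`rfl`), on an inactive one `δ₀ ⊗ δ₀ = δ_{(0,0)}` (`dirac_prod_dirac`). -/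
theorem μS_eq_prod (S : Finset (Fin n)) (j : Fin n) : μS S j = (sS S j).prod (θS S j) := by
  unfold μS sS θS
  split_ifs with h
  · rfl
  · rw [Measure.dirac_prod_dirac]; rfl

/-- [folklore] … hence for the whole family of cubes. -/
theorem pi_μS_eq_pi_prod (S : Finset (Fin n)) : Measure.pi (μS S) = Measure.pi fun j => (sS S j).prod (θS S j) := by
  have h : μS S = fun j => (sS S j).prod (θS S j) := funext (μS_eq_prod S)
  rw [h]

/-- [folklore] The inverse of Mathlib's `arrowProdEquivProdArrow` IS W55's configuration map: `(s, θ) ↦ (j ↦ (s_j, θ_j)) = pairθ s θ`. -/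
theorem arrowProdEquivProdArrow_symm_apply (q : (Fin n → ℝ) × (Fin n → ℝ)) :
    (MeasurableEquiv.arrowProdEquivProdArrow ℝ ℝ (Fin n)).symm q = pairθ q.1 q.2 := rfl

/-- **THE ZIP IS MEASURE PRESERVING** [folklore] (Mathlib `measurePreserving_arrowProdEquivProdArrow` through §1's split): `(s, θ) ↦ pairθ s θ`
carries `(⨂_j sS S j) ⊗ (⨂_j θS S j)` — interpolation cube times angular torus of the active cubes, Dirac fillers elsewhere — to W39.1's `⨂_j μS S j`. -/
theorem measurePreserving_zip (S : Finset (Fin n)) :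
    MeasurePreserving (MeasurableEquiv.arrowProdEquivProdArrow ℝ ℝ (Fin n)).symm
      ((Measure.pi (sS S)).prod (Measure.pi (θS S))) (Measure.pi (μS S)) := by
  rw [pi_μS_eq_pi_prod]
  exact (measurePreserving_arrowProdEquivProdArrow ℝ ℝ (Fin n) (sS S) (θS S)).symm _

/-- **THE SPLIT, FOR EVERY INTEGRAND** [folklore] (a measurable equivalence needs no integrability):
`∫ G d(⨂ μS S) = ∫ G(pairθ s θ) d((⨂ sS S) ⊗ (⨂ θS S))(s, θ)`. -/
theorem integral_μS_eq_integral_prod {E : Type*} [NormedAddCommGroup E] [NormedSpace ℝ E] (S : Finset (Fin n))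
    (G : (Fin n → ℝ × ℝ) → E) :
    ∫ p, G p ∂(Measure.pi (μS S)) = ∫ q, G (pairθ q.1 q.2) ∂((Measure.pi (sS S)).prod (Measure.pi (θS S))) := by
  rw [← (measurePreserving_zip S).integral_comp' G]
  rfl

/-- [folklore] Integrability transports along the zip. -/
theorem integrable_zip_iff {E : Type*} [NormedAddCommGroup E] (S : Finset (Fin n)) {G : (Fin n → ℝ × ℝ) → E}
    (hG : AEStronglyMeasurable G (Measure.pi (μS S))) :
    Integrable (fun q : (Fin n → ℝ) × (Fin n → ℝ) => G (pairθ q.1 q.2)) ((Measure.pi (sS S)).prod (Measure.pi (θS S))) ↔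
      Integrable G (Measure.pi (μS S)) :=
  (measurePreserving_zip S).integrable_comp hG

/-- **THE SPLIT, ITERATED — `ds` OUTSIDE, `dθ` INSIDE** [folklore] (§1 + Fubini `integral_prod`): for `G` integrable against `⨂ μS S`,
`∫ G d(⨂ μS S) = ∫ (∫ G(pairθ s θ) d(⨂_j θS S j)) d(⨂_j sS S j)` — (1.23)'s displayed order «∫ ds(Δ) … ∮ dσ(Δ)» for all cubes at once. -/
theorem integral_μS_eq_integral_sS_θS {E : Type*} [NormedAddCommGroup E] [NormedSpace ℝ E] (S : Finset (Fin n))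
    {G : (Fin n → ℝ × ℝ) → E} (hG : Integrable G (Measure.pi (μS S))) :
    ∫ p, G p ∂(Measure.pi (μS S)) = ∫ s, (∫ θ, G (pairθ s θ) ∂(Measure.pi (θS S))) ∂(Measure.pi (sS S)) := by
  rw [integral_μS_eq_integral_prod]
  exact integral_prod _ ((integrable_zip_iff S hG.aestronglyMeasurable).2 hG)

/-! ## §2 W39.1's CUBE LETTER IS THE `ds`-INTEGRAL OF W55's ANGULAR LETTER; the three routes commute -/

/-- [folklore] The substrate's Cauchy weight reads the interpolation parameter THROUGH THE CLAMP: `cw r S j (s, θ) = cw r S j (interp s, θ)`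
(`w₁ r p` contains `interp p.1`, and `interp ∘ interp = interp`). -/
theorem cw_interp (r : Fin n → ℝ) (S : Finset (Fin n)) (j : Fin n) (x θ : ℝ) : cw r S j (x, θ) = cw r S j (interp x, θ) := by
  unfold cw w₁
  rw [interp_eq_self (interp_nonneg x) (interp_le_one x)]

/-- [folklore] … hence so does the product weight: `wS r S (pairθ s θ) = wS r S (pairθ (interp ∘ s) θ)`. -/
theorem wS_pairθ_interp (r : Fin n → ℝ) (S : Finset (Fin n)) (s θ : Fin n → ℝ) :
    wS r S (pairθ s θ) = wS r S (pairθ (fun j => interp (s j)) θ) := by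
  unfold wS pairθ
  exact Finset.prod_congr rfl fun j _ => cw_interp r S j (s j) (θ j)

/-- [folklore] The contour configuration does not read the interpolation parameter at all. -/
theorem σS_pairθ (r : Fin n → ℝ) (S : Finset (Fin n)) (s s' θ : Fin n → ℝ) : σS r S (pairθ s θ) = σS r S (pairθ s' θ) := by
  funext j; simp only [σS, σc, pairθ]

/-- **W55's REPRESENTATION AT EVERY PARAMETER, READ THROUGH THE CLAMP** (W55 `mixedDerivLetter_rep` BY NAME at the clamped point `interp ∘ s ∈
[0,1]ⁿ`, moved back by `wS_pairθ_interp`∕`σS_pairθ`): for radii `> 1`, `F` jointly entire-analytic and ANY `s ∈ ℝⁿ`,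
`∫ wS r S (s,θ)·F(σ_S(s,θ)) d(⨂ θS S)(θ) = ∂_{enumS S} F (cubePt S s)` — no `s ∈ [0,1]^S` hypothesis, no a.e. [folklore] -/
theorem angularLetter_eq_mixedDeriv_cubePt (r : Fin n → ℝ) (hr : ∀ j, 1 < r j) (S : Finset (Fin n)) (F : (Fin n → ℂ) → ℂ)
    (hF : AnalyticOnNhd ℂ F univ) (s : Fin n → ℝ) :
    ∫ θ, wS r S (pairθ s θ) * F (σS r S (pairθ s θ)) ∂(Measure.pi (θS S)) = mixedDeriv (enumS n S) F (cubePt S s) := by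
  have h := mixedDerivLetter_rep n r S F (fun j => interp (s j)) hr hF fun j _ => ⟨interp_nonneg _, interp_le_one _⟩
  simp_rw [wS_pairθ_interp r S s, σS_pairθ r S s (fun j => interp (s j))]
  exact h

/-- [folklore] W39.1's integrand is integrable against `⨂ μS S` for radii `> 1` and `F` continuous (measurable; bounded since the configuration
stays in the compact polydisc of radii `r` — the step internal to W39.1's proof, as a lemma). -/
theorem integrable_letter (r : Fin n → ℝ) (hr : ∀ j, 1 < r j) (S : Finset (Fin n)) {F : (Fin n → ℂ) → ℂ} (hF : Continuous F) :
    Integrable (fun p => wS r S p * F (σS r S p)) (Measure.pi (μS S)) := by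
  have hr0 : ∀ j, 0 ≤ r j := fun j => zero_le_one.trans (hr j).le
  have hGm : Measurable fun p => wS r S p * F (σS r S p) :=
    (measurable_wS r S).mul (hF.measurable.comp (measurable_σS r S))
  obtain ⟨B, hB⟩ : ∃ B, ∀ p, ‖F (σS r S p)‖ ≤ B := by
    obtain ⟨B, hB⟩ := (isCompact_closedBall (0 : Fin n → ℂ) (∑ j, r j)).exists_bound_of_continuousOn hF.continuousOn
    refine ⟨B, fun p => hB _ (mem_closedBall_zero_iff.2 ((pi_norm_le_iff_of_nonneg
      (Finset.sum_nonneg fun j _ => hr0 j)).2 fun j => (norm_σS_le hr0 S p j).trans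
        (Finset.single_le_sum (fun j _ => hr0 j) (Finset.mem_univ j))))⟩
  refine Integrable.mono' (integrable_const ((∏ j, max (wB₁ (r j)) 1) * B)) hGm.aestronglyMeasurable
    (Filter.Eventually.of_forall fun p => ?_)
  rw [norm_mul]
  exact mul_le_mul (norm_wS_le hr S p) (hB p) (norm_nonneg _) (Finset.prod_nonneg fun _ _ => zero_le_one.trans (le_max_right _ _))

/-- **W39.1's CUBE LETTER IS LITERALLY THE `ds`-INTEGRAL OF W55's ANGULAR LETTER** (§1's split at W39.1's integrand): for radii `> 1` and `F`
continuous, `∫ wS·F∘σS d(⨂ μS S) = ∫ (∫ wS r S (s,θ)·F(σ_S(s,θ)) d(⨂ θS S)(θ)) d(⨂ sS S)(s)` — (1.23)∕(2.14)'s «∫ ds(Δ) (1∕2πi) ∫ dσ(Δ)∕(σ(Δ)−s(Δ))²»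
(TYPE) with the interpolation integrals OUTSIDE and the contours INSIDE, all active cubes collected. [folklore] -/
theorem mixedLetter_eq_integral_angularLetter (r : Fin n → ℝ) (hr : ∀ j, 1 < r j) (S : Finset (Fin n)) (F : (Fin n → ℂ) → ℂ)
    (hF : Continuous F) :
    ∫ p, wS r S p * F (σS r S p) ∂(Measure.pi (μS S)) =
      ∫ s, (∫ θ, wS r S (pairθ s θ) * F (σS r S (pairθ s θ)) ∂(Measure.pi (θS S))) ∂(Measure.pi (sS S)) :=
  integral_μS_eq_integral_sS_θS S (integrable_letter r hr S hF)

/-- **W62 §3 RE-DERIVED BY FUBINI** (§2's split + W55 at every parameter; W39.1's induction is NOT used): for radii `> 1` and `F` jointly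
entire-analytic, `∫ wS·F∘σS d(⨂ μS S) = ∫ ∂_{enumS S} F (cubePt S s) d(⨂ sS S)(s)` — the statement of W62's `mixedLetter_eq_integral_mixedDeriv`,
reached there through W39.1 + the FTC, here through the split + the contours at fixed `s`. [folklore] -/
theorem mixedLetter_eq_integral_mixedDeriv' (r : Fin n → ℝ) (hr : ∀ j, 1 < r j) (S : Finset (Fin n)) (F : (Fin n → ℂ) → ℂ)
    (hF : AnalyticOnNhd ℂ F univ) :
    ∫ p, wS r S p * F (σS r S p) ∂(Measure.pi (μS S)) = ∫ s, mixedDeriv (enumS n S) F (cubePt S s) ∂(Measure.pi (sS S)) := by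
  rw [mixedLetter_eq_integral_angularLetter r hr S F (continuousOn_univ.1 hF.continuousOn)]
  simp_rw [angularLetter_eq_mixedDeriv_cubePt r hr S F hF]

/-- **THE THREE ROUTES COMMUTE — W39.1's REPRESENTATION RE-DERIVED** (§2 + W62 §2 `integral_mixedDeriv_cubePt_eq_mixedDiff` BY NAME; CENSUS:
W39.1's `mixedLetter_rep` is used NOWHERE in this file): for radii `> 1` and `F` jointly entire-analytic, `∫ wS·F∘σS d(⨂ μS S) = Δ_S F` — contours
at fixed `s` (W55), then `∫ ds` of Dimock's derivative (W62), land on Bałaban's mixed difference (W39.1 has `F` jointly ℂ-differentiable; analytic ⇒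
differentiable, the converse for `ℂⁿ` (Osgood) is not in Mathlib — the analytic hypothesis is kept). [folklore] -/
theorem mixedLetter_rep_of_split (r : Fin n → ℝ) (hr : ∀ j, 1 < r j) (S : Finset (Fin n)) (F : (Fin n → ℂ) → ℂ)
    (hF : AnalyticOnNhd ℂ F univ) :
    ∫ p, wS r S p * F (σS r S p) ∂(Measure.pi (μS S)) = mixedDiff n S F := by
  rw [mixedLetter_eq_integral_mixedDeriv' r hr S F hF, integral_mixedDeriv_cubePt_eq_mixedDiff n S F hF]

/-! ## §3 The interpolation cube has mass one; W39.1's (2.15)-majorant RE-DERIVED by integrating W55's angular majorant over it -/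

/-- [folklore] Every interpolation coordinate measure has MASS ONE (`|[0,1]| = 1`; a Dirac mass is one). -/
theorem sS_univ_eq_one (S : Finset (Fin n)) (j : Fin n) : sS S j univ = 1 := by
  unfold sS; split_ifs
  · rw [Measure.restrict_apply_univ, Real.volume_Icc, sub_zero, ENNReal.ofReal_one]
  · exact measure_univ

/-- [folklore] … hence so has the interpolation cube `⨂_j sS S j` (Mathlib `Measure.pi_univ`). -/
theorem pi_sS_univ (S : Finset (Fin n)) : Measure.pi (sS S) univ = 1 := (Measure.pi_univ _).trans (prod_eq_one fun j _ => sS_univ_eq_one S j)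

/-- **W39.1's (2.15)-MAJORANT RE-DERIVED THROUGH THE SPLIT** (§1 at the norm of W39.1's integrand + W55 `mixedDerivLetter_majorant_le` at every
`s` + mass one): if `‖F∘σS‖ ≤ B` on the contour configurations (a HYPOTHESIS of (1.18)∕(1.21) TYPE), then
`∫ ‖wS·F∘σS‖ d(⨂ μS S) ≤ (Π_{j∈S} r_j∕(r_j − 1)²)·B` — ONE factor `r∕(r−1)²` per active cube; the statement of W39.1's `mixedLetter_majorant_le`
(for `F` continuous), reached by integrating the ANGULAR cost over the unit cube instead of cube by cube. [folklore] -/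
theorem mixedLetter_majorant_of_split {r : Fin n → ℝ} (hr : ∀ j, 1 < r j) (S : Finset (Fin n)) {F : (Fin n → ℂ) → ℂ}
    (hF : Continuous F) {B : ℝ} (hB : ∀ p, ‖F (σS r S p)‖ ≤ B) :
    ∫ p, ‖wS r S p * F (σS r S p)‖ ∂(Measure.pi (μS S)) ≤ (∏ j ∈ S, r j / (r j - 1) ^ 2) * B := by
  rw [integral_μS_eq_integral_sS_θS S (integrable_letter r hr S hF).norm]
  calc ∫ s, (∫ θ, ‖wS r S (pairθ s θ) * F (σS r S (pairθ s θ))‖ ∂(Measure.pi (θS S))) ∂(Measure.pi (sS S))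
      ≤ ∫ _s, (∏ j ∈ S, r j / (r j - 1) ^ 2) * B ∂(Measure.pi (sS S)) :=
        integral_mono_of_nonneg (Filter.Eventually.of_forall fun _ => integral_nonneg fun _ => norm_nonneg _) (integrable_const _)
          (Filter.Eventually.of_forall fun s => mixedDerivLetter_majorant_le hr S s hB)
    _ = (∏ j ∈ S, r j / (r j - 1) ^ 2) * B := by rw [integral_const, measureReal_def, pi_sS_univ, ENNReal.toReal_one, one_smul]

/-! ## §4 The clamp is invisible to the interpolation cube: the UNCLAMPED cube identity -/

/-- **`cubePt = basePt` ALMOST EVERYWHERE on the interpolation cube** [folklore] (Mathlib `ae_eq_pi` coordinatewise: on an active cube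
`ds|[0,1]`-a.e. `s ∈ [0,1]` where the substrate's `interp` is the identity (`interp_eq_self`); on an inactive one both points read `0`). -/
theorem cubePt_ae_eq_basePt (S : Finset (Fin n)) : cubePt S =ᵐ[Measure.pi (sS S)] basePt S := by
  have h : ∀ j : Fin n, (fun x : ℝ => if j ∈ S then ((interp x : ℝ) : ℂ) else 0) =ᵐ[sS S j]
      fun x => if j ∈ S then ((x : ℝ) : ℂ) else 0 := by
    intro j
    unfold sS
    split_ifs with hj
    · filter_upwards [ae_restrict_mem measurableSet_Icc] with x hx
      rw [interp_eq_self hx.1 hx.2]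
    · exact Filter.EventuallyEq.rfl
  filter_upwards [Measure.ae_eq_pi h] with s hs
  funext j
  have hsj := congrFun hs j
  unfold cubePt basePt
  simpa using hsj

/-- **THE UNCLAMPED CUBE IDENTITY** (W62 §2 `integral_mixedDeriv_cubePt_eq_mixedDiff` BY NAME + §4's a.e. equality): for `F` jointly entire-analytic,
`∫ ∂_{enumS S} F (basePt S s) d(⨂_j sS S j)(s) = Δ_S F` — W62 stated the FTC at the clamped `cubePt S s` (its integrability device); the interpolation
cube does not see the clamp, so the identity holds verbatim at `basePt S s` = «(s on S, 0 off S)». [folklore] -/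
theorem integral_mixedDeriv_basePt_eq_mixedDiff (S : Finset (Fin n)) (F : (Fin n → ℂ) → ℂ) (hF : AnalyticOnNhd ℂ F univ) :
    ∫ s, mixedDeriv (enumS n S) F (basePt S s) ∂(Measure.pi (sS S)) = mixedDiff n S F := by
  rw [← integral_mixedDeriv_cubePt_eq_mixedDiff n S F hF]
  exact integral_congr_ae ((cubePt_ae_eq_basePt S).mono fun s (hs : cubePt S s = basePt S s) => by
    show mixedDeriv (enumS n S) F (basePt S s) = mixedDeriv (enumS n S) F (cubePt S s)
    rw [hs])

/-- **… and W39.1's letter with the UNCLAMPED point** (§2 + §4): `∫ wS·F∘σS d(⨂ μS S) = ∫ ∂_{enumS S} F (basePt S s) d(⨂ sS S)(s)`. [folklore] -/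
theorem mixedLetter_eq_integral_mixedDeriv_basePt (r : Fin n → ℝ) (hr : ∀ j, 1 < r j) (S : Finset (Fin n)) (F : (Fin n → ℂ) → ℂ)
    (hF : AnalyticOnNhd ℂ F univ) :
    ∫ p, wS r S p * F (σS r S p) ∂(Measure.pi (μS S)) = ∫ s, mixedDeriv (enumS n S) F (basePt S s) ∂(Measure.pi (sS S)) := by
  rw [mixedLetter_rep_of_split r hr S F hF, integral_mixedDeriv_basePt_eq_mixedDiff S F hF]

/-! ## §5 At `S = univ`: the substrate's `lamJ (Fin n)`-letter in (2.14)'s displayed order -/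

/-- [folklore] With every cube active the interpolation measures are `ds|[0,1]` on every coordinate. -/
theorem sS_univ (n : ℕ) : sS (Finset.univ : Finset (Fin n)) = fun _ => volume.restrict (Icc (0 : ℝ) 1) := by
  funext j; simp [sS]

/-- **THE SUBSTRATE's `n`-VARIABLE LETTER, `ds` OUTSIDE** (§2 at `S = univ` via W39.1's `pi_μS_univ`∕`wS_univ`∕`σS_univ`, W55's `θS_univ`, `sS_univ`):
for radii `> 1` and `F` continuous, `∫ wJ r p·F(sigmaJ r p) dlamJ(p) = ∫_{[0,1]ⁿ} (∫_{[0,2π]ⁿ} wJ r (s,θ)·F(sigmaJ r (s,θ)) dθ) ds` — (2.14)'s cube block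
(p. 15, TYPE) for `Support/B13TermContours` §2's contour space. [folklore] -/
theorem substrateLetter_eq_integral_angularLetter (r : Fin n → ℝ) (hr : ∀ j, 1 < r j) (F : (Fin n → ℂ) → ℂ) (hF : Continuous F) :
    ∫ p, wJ r p * F (sigmaJ r p) ∂(lamJ (Fin n)) =
      ∫ s, (∫ θ, wJ r (pairθ s θ) * F (sigmaJ r (pairθ s θ)) ∂(Measure.pi fun _ : Fin n => volume.restrict (Icc (0 : ℝ) (2 * Real.pi))))
        ∂(Measure.pi fun _ : Fin n => volume.restrict (Icc (0 : ℝ) 1)) := by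
  rw [← pi_μS_univ, ← wS_univ, ← σS_univ, ← θS_univ, ← sS_univ]
  exact mixedLetter_eq_integral_angularLetter r hr _ F hF

/-! ## §6 Decided checks in (1.23)'s order -/

/-- DECIDED CHECK (two active cubes, the NON-product entire factor `e^{z₀z₁}`, ANY radii `> 1`): in print's order — interpolation integrals
outside, contours inside — `∫_{[0,1]²} ds ∮∮ wS·e^{σ₀σ₁} = Δ_{01} e^{z₀z₁} = e − 1 − (1 − 1) = e − 1` (§2 + W39.1 `mixedDiff_pair`). -/
example (r : Fin 2 → ℝ) (hr : ∀ j, 1 < r j) :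
    ∫ s, (∫ θ, wS r {0, 1} (pairθ s θ) * Complex.exp (σS r {0, 1} (pairθ s θ) 0 * σS r {0, 1} (pairθ s θ) 1) ∂(Measure.pi (θS {0, 1})))
      ∂(Measure.pi (sS {0, 1})) = Complex.exp 1 - 1 := by
  have hF : AnalyticOnNhd ℂ (fun z : Fin 2 → ℂ => Complex.exp (z 0 * z 1)) univ :=
    ((analyticOnNhd_apply 0).mul (analyticOnNhd_apply 1)).cexp
  have h := mixedLetter_eq_integral_angularLetter r hr {0, 1} (fun z : Fin 2 → ℂ => Complex.exp (z 0 * z 1))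
    (continuousOn_univ.1 hF.continuousOn)
  rw [← h, mixedLetter_rep_of_split r hr {0, 1} _ hF, mixedDiff_pair]
  simp

/-- DECIDED CHECK (the second cube DECOUPLED, `S = {0}`): the same iterated letter of `e^{z₀z₁}` is `Δ_{0} e^{z₀z₁} = e^{1·0} − e^{0·0} = 0` — with
`σ₁` frozen at the decoupled value the factor does not see `σ₀` (§2 + W39.1 `mixedDiff_zero`). -/
example (r : Fin 2 → ℝ) (hr : ∀ j, 1 < r j) :
    ∫ s, (∫ θ, wS r {0} (pairθ s θ) * Complex.exp (σS r {0} (pairθ s θ) 0 * σS r {0} (pairθ s θ) 1) ∂(Measure.pi (θS {0})))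
      ∂(Measure.pi (sS {0})) = 0 := by
  have hF : AnalyticOnNhd ℂ (fun z : Fin 2 → ℂ => Complex.exp (z 0 * z 1)) univ :=
    ((analyticOnNhd_apply 0).mul (analyticOnNhd_apply 1)).cexp
  have h := mixedLetter_eq_integral_angularLetter r hr {0} (fun z : Fin 2 → ℂ => Complex.exp (z 0 * z 1))
    (continuousOn_univ.1 hF.continuousOn)
  rw [← h, mixedLetter_rep_of_split r hr {0} _ hF, mixedDiff_zero]
  simp

end Summit.QuantumFields.BalabanUV.T4Continuum.NE1p.DressedSmallFieldMixedDerivativeSplit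

end
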